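import Literature.Probability.LatticeModels.IsingTransferOperator
import HarnessLib

/-!
# The diagonal-to-diagonal transfer matrix of the square-lattice Ising model commutes with the transverse-field Ising chain

Topic `Probability/LatticeModels`, namespace `Literature.Probability.LatticeModels`. First file of
the exact computation of the critical DIAGONAL correlations `⟨σ_{(0,0)}σ_{(n,n)}⟩_{β_c}` of the
planar Ising model (T. T. Wu, Phys. Rev. 149 (1966) 380; B. M. McCoy, T. T. Wu, *The two-dimensional
Ising model* (1973), Ch. XI) behind the named fact `Literature.Probability.LatticeModels.wu_rhoCHI`
(`PlanarIsingOnePoint.lean`), along the route "diagonal transfer matrix ↔ quantum Ising chain":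

* R. J. Baxter, *Exactly solved models in statistical mechanics* (1982), §7.2: the square lattice
  drawn diagonally and its diagonal-to-diagonal transfer matrices
  `V_{φφ'} = exp[∑_j (K φ_{j+1}φ'_j + L φ_jφ'_j)]` — each spin of a diagonal layer is coupled to two
  spins of the previous layer;
* M. Suzuki, Prog. Theor. Phys. **46** (1971) 1337–1359 (abstract: "By relating a transfer matrix
  associated with a classical system to the Hamiltonian of its corresponding quantum mechanical
  system, it is proved that the two-dimensional Ising model in the absence of a magnetic field is
  equivalent to the ground state of the linear XY-model in the presence of a magnetic field, under
  appropriate relations among coupling parameters"): for the nearest-neighbour square lattice the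
  commuting quantum chain is the transverse-field Ising chain;
* P. Pfeuty, Ann. Phys. **57** (1970) 79–90: the transverse-field Ising chain, its exact solution
  by the method of Lieb–Schultz–Mattis (Ann. Phys. 16 (1961) 407) and its ground-state correlations
  as Toeplitz determinants (in closed form at the critical field).

This file constructs the one-layer **diagonal transfer kernel** on the register row space
`ℝ^{Row N}` of `IsingTorusTransfer` (a diagonal layer of `ℤ²` wrapped with period `N`; the spin at
register `i` of the next layer is coupled to the spins at registers `i` and `i+1` of the previous
one, Baxter's `V` with `K = L = β`),

  `K(r, r') = exp(β ∑_i r'_i (r_i + r_{i+1}))`     (`diagKernel`),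

the two-layer symmetric matrix `T₂ = Kᵀ K` (`diagTwoLayer`: positive semidefinite, strictly positive
entries), the transverse-field Ising chain `tfiHam N h = -diag(∑_i r_i r_{i+1}) - h ∑_i σˣ_i` as a
real symmetric matrix on the same space, and PROVES the commutation

  `K H = H K`, `T₂ H = H T₂`  at  `h = diagField β = (sinh 2β)⁻²`   (`diagKernel_mul_tfiHam`,
  `diagTwoLayer_mul_tfiHam`),

by an elementary local computation: dividing `(HK - KH)(r, r'')` by `K(r, r'') > 0` leaves
`E(r'') - E(r) = h ∑_i [e^{-2β r_i (r''_i + r''_{i-1})} - e^{-2β r''_i (r_i + r_{i+1})}]`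
(`E(r) = ∑_i r_i r_{i+1}`); with `e^{-2β s(a+b)} = 1 + (cosh 4β - 1)(1 + ab)/2 - (sinh 4β/2) s(a+b)`
for `s, a, b = ±1` (`exp_neg_two_mul_spin_sum`) the `sinh` terms telescope around the ring and the
`cosh` terms give `(cosh 4β - 1)/2 · (E(r'') - E(r))`, whence the condition
`h (cosh 4β - 1)/2 = 1`, i.e. `h = (sinh 2β)⁻²` — `= 1` at `β = β_c(2)` (`sinh 2β_c = 1`): at the
critical temperature the commuting chain is the CRITICAL transverse-field Ising chain.
Everything is proved; no named fact is introduced. (Numerical sanity check, session notes: for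
`N = 4, 5` and `β ∈ {0.3, β_c, 0.7}` the relative commutator `‖[T₂, H(h)]‖/‖T₂‖` vanishes to machine
precision at `h = (sinh 2β)⁻²` and is of order one at other fields.) The Perron vector of `T₂` (the
diagonal cylinder state), its identification with the ground state of `H`, the fermionic solution
and the torus bookkeeping are the business of the sequel files.

## References

* R. J. Baxter, *Exactly solved models in statistical mechanics*, Academic Press (1982), §7.2.
* M. Suzuki, Prog. Theor. Phys. 46 (1971) 1337–1359.
* P. Pfeuty, Ann. Phys. 57 (1970) 79–90.
* E. Lieb, T. Schultz, D. Mattis, Ann. Phys. 16 (1961) 407–466.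
* T. D. Schultz, D. C. Mattis, E. H. Lieb, Rev. Mod. Phys. 36 (1964) 856–871, §II.
* B. M. McCoy, T. T. Wu, *The two-dimensional Ising model*, Harvard Univ. Press (1973), Ch. XI.
-/

noncomputable section

open Matrix Finset

namespace Literature.Probability.LatticeModels

variable {N : ℕ}

/-! ### Spins of flipped rows -/

/-- The spin at the flipped site changes sign. [folklore] -/
theorem spinAt_flipAt_same (i : Fin N) (r : Row N) : spinAt i (Row.flipAt i r) = -spinAt i r := by
  simp [spinAt, Row.flipAt_apply_same]

/-- The spins off the flipped site are unchanged. [folklore] -/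
theorem spinAt_flipAt_ne {i j : Fin N} (h : j ≠ i) (r : Row N) : spinAt j (Row.flipAt i r) = spinAt j r := by
  simp [spinAt, Row.flipAt_apply_ne h]

/-- The spins of a flipped row as a correction of the original ones:
`(flipAt i r)_j = r_j - 2·[j = i] r_i`. [folklore] -/
theorem spinAt_flipAt_eq_sub (i j : Fin N) (r : Row N) :
    spinAt j (Row.flipAt i r) = spinAt j r - 2 * (if j = i then spinAt i r else 0) := by
  by_cases h : j = i
  · subst h
    rw [spinAt_flipAt_same, if_pos rfl]
    ring
  · rw [spinAt_flipAt_ne h, if_neg h]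
    ring

/-- Spins of the globally reversed row. [folklore] -/
theorem spinAt_neg_row (i : Fin N) (r : Row N) : spinAt i (-r) = -spinAt i r := spinAt_neg i r

variable [NeZero N]

/-! ### Energies of a register ring and of a diagonal step -/

/-- The nearest-neighbour energy of a register ring, `E(r) = ∑_i r_i r_{i+1}` (indices mod `N`). [cite: SchultzMattisLieb1964, §II] -/
def ringEnergy (r : Row N) : ℝ := ∑ i, spinAt i r * spinAt (i + 1) r

/-- The **interlayer energy of a diagonal step**: the spin at register `i` of the new layer `r'` is
coupled to the spins at registers `i` and `i+1` of the old layer `r`,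
`E(r, r') = ∑_i r'_i (r_i + r_{i+1})` (the square lattice drawn diagonally: each site of a diagonal
layer has exactly two neighbours in the previous layer; Baxter's `V_{φφ'}` with `K = L = β`,
`φ = r`, `φ' = r'`). [cite: BaxterExactlySolved1982, §7.2 (diagonal-to-diagonal transfer matrices V, W)] -/
def diagEnergy (r r' : Row N) : ℝ := ∑ i, spinAt i r' * (spinAt i r + spinAt (i + 1) r)

/-- Flipping the new spin at `i`: `E(r, flip_i r') = E(r, r') - 2 r'_i (r_i + r_{i+1})`. [folklore] -/
theorem diagEnergy_flipAt_right (i : Fin N) (r r' : Row N) :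
    diagEnergy r (Row.flipAt i r') = diagEnergy r r' - 2 * (spinAt i r' * (spinAt i r + spinAt (i + 1) r)) := by
  simp only [diagEnergy, spinAt_flipAt_eq_sub i, sub_mul, Finset.sum_sub_distrib, mul_assoc, ← Finset.mul_sum,
    ite_mul, zero_mul, Finset.sum_ite_eq', Finset.mem_univ, if_true]

/-- Flipping the old spin at `i`: `E(flip_i r, r') = E(r, r') - 2 r_i (r'_i + r'_{i-1})` (the old
spin `r_i` is seen by the new spins at `i` and at `i - 1`). [folklore] -/
theorem diagEnergy_flipAt_left (i : Fin N) (r r' : Row N) :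
    diagEnergy (Row.flipAt i r) r' = diagEnergy r r' - 2 * (spinAt i r * (spinAt i r' + spinAt (i - 1) r')) := by
  have hcond : ∀ j : Fin N, (j + 1 = i) = (j = i - 1) := fun j => propext eq_sub_iff_add_eq.symm
  simp only [diagEnergy, spinAt_flipAt_eq_sub i, hcond, mul_add, mul_sub, Finset.sum_add_distrib,
    Finset.sum_sub_distrib, mul_ite, mul_zero, Finset.sum_ite_eq', Finset.mem_univ, if_true]
  ring

/-- Reversing all spins of both layers does not change the interlayer energy. [folklore] -/
theorem diagEnergy_neg_neg (r r' : Row N) : diagEnergy (-r) (-r') = diagEnergy r r' := by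
  simp only [diagEnergy, spinAt_neg_row]
  refine Finset.sum_congr rfl fun i _ => ?_
  ring

/-- Reversing all spins does not change the ring energy. [folklore] -/
theorem ringEnergy_neg (r : Row N) : ringEnergy (-r) = ringEnergy r := by
  simp only [ringEnergy, spinAt_neg_row, neg_mul_neg]

/-! ### The diagonal transfer kernel and the two-layer transfer matrix -/

variable (N) in
/-- The **one-layer diagonal transfer kernel** `K(r, r') = exp(β ∑_i r'_i (r_i + r_{i+1}))` of the
square-lattice Ising model at inverse temperature `β` between consecutive diagonal layers of `N`
registers (Baxter 1982, §7.2, `V` with `K = L = β`). [cite: BaxterExactlySolved1982, §7.2 (diagonal-to-diagonal transfer matrices V, W)] -/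
def diagKernel (β : ℝ) : Matrix (Row N) (Row N) ℝ := fun r r' => Real.exp (β * diagEnergy r r')

/-- Unfolding of the kernel. [folklore] -/
theorem diagKernel_apply (β : ℝ) (r r' : Row N) : diagKernel N β r r' = Real.exp (β * diagEnergy r r') := rfl

/-- The kernel has strictly positive entries. [folklore] -/
theorem diagKernel_apply_pos (β : ℝ) (r r' : Row N) : 0 < diagKernel N β r r' := Real.exp_pos _

/-- The kernel is invariant under the global spin reversal of both layers. [folklore] -/
theorem diagKernel_neg_neg (β : ℝ) (r r' : Row N) : diagKernel N β (-r) (-r') = diagKernel N β r r' := by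
  rw [diagKernel_apply, diagKernel_apply, diagEnergy_neg_neg]

/-- Kernel ratio under a flip of the new layer:
`K(r, flip_i r') = K(r, r') · exp(-2β r'_i (r_i + r_{i+1}))`. [folklore] -/
theorem diagKernel_flipAt_right (β : ℝ) (i : Fin N) (r r' : Row N) :
    diagKernel N β r (Row.flipAt i r') =
      diagKernel N β r r' * Real.exp (-(2 * β) * (spinAt i r' * (spinAt i r + spinAt (i + 1) r))) := by
  rw [diagKernel_apply, diagKernel_apply, diagEnergy_flipAt_right, ← Real.exp_add]
  congr 1
  ring

/-- Kernel ratio under a flip of the old layer: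
`K(flip_i r, r') = K(r, r') · exp(-2β r_i (r'_i + r'_{i-1}))`. [folklore] -/
theorem diagKernel_flipAt_left (β : ℝ) (i : Fin N) (r r' : Row N) :
    diagKernel N β (Row.flipAt i r) r' =
      diagKernel N β r r' * Real.exp (-(2 * β) * (spinAt i r * (spinAt i r' + spinAt (i - 1) r'))) := by
  rw [diagKernel_apply, diagKernel_apply, diagEnergy_flipAt_left, ← Real.exp_add]
  congr 1
  ring

variable (N) in
/-- The **two-layer diagonal transfer matrix** `T₂ = Kᵀ K`: two consecutive diagonal steps, the
intermediate layer summed out (Baxter's `V W`-type product, here symmetrised as `Kᵀ K`); a real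
symmetric matrix. [cite: BaxterExactlySolved1982, §7.2 (diagonal-to-diagonal transfer matrices V, W)] -/
def diagTwoLayer (β : ℝ) : Matrix (Row N) (Row N) ℝ := (diagKernel N β)ᵀ * diagKernel N β

/-- `T₂` entrywise: `T₂(r, r') = ∑_{r''} K(r'', r) K(r'', r')`. [folklore] -/
theorem diagTwoLayer_apply (β : ℝ) (r r' : Row N) :
    diagTwoLayer N β r r' = ∑ r'', diagKernel N β r'' r * diagKernel N β r'' r' := by
  rw [diagTwoLayer, Matrix.mul_apply]
  rfl

/-- `T₂` has strictly positive entries. [folklore] -/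
theorem diagTwoLayer_apply_pos (β : ℝ) (r r' : Row N) : 0 < diagTwoLayer N β r r' := by
  rw [diagTwoLayer_apply]
  exact Finset.sum_pos (fun r'' _ => mul_pos (diagKernel_apply_pos β r'' r) (diagKernel_apply_pos β r'' r'))
    Finset.univ_nonempty

/-- `T₂ = Kᵀ K` is positive semidefinite (a Gram matrix). [folklore] -/
theorem diagTwoLayer_posSemidef (β : ℝ) : (diagTwoLayer N β).PosSemidef := by
  rw [diagTwoLayer, ← conjTranspose_eq_transpose_of_trivial]
  exact Matrix.posSemidef_conjTranspose_mul_self _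

/-- `T₂ = Kᵀ K` is symmetric. [folklore] -/
theorem diagTwoLayer_isHermitian (β : ℝ) : (diagTwoLayer N β).IsHermitian := (diagTwoLayer_posSemidef β).1

/-- `T₂` is invariant under the global spin reversal. [folklore] -/
theorem diagTwoLayer_neg_neg (β : ℝ) (r r' : Row N) : diagTwoLayer N β (-r) (-r') = diagTwoLayer N β r r' := by
  rw [diagTwoLayer_apply, diagTwoLayer_apply]
  rw [← Equiv.sum_comp (Equiv.neg (Row N))]
  refine Finset.sum_congr rfl fun r'' _ => ?_
  rw [Equiv.neg_apply, diagKernel_neg_neg, diagKernel_neg_neg]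

/-! ### The transverse-field Ising chain on the row space -/

variable (N) in
/-- The total spin-flip operator `∑_i σˣ_i` (the transverse field). [cite: PfeutyAnnPhys1970, §1 (the Hamiltonian)] -/
def flipSum : Matrix (Row N) (Row N) ℝ := ∑ i, sigmaX i

variable (N) in
/-- The **transverse-field Ising chain** with periodic boundary conditions on `N` sites, as a real
symmetric matrix on `ℝ^{Row N}` in the basis where `σᶻ` is diagonal:
`H = -∑_i σᶻ_i σᶻ_{i+1} - h ∑_i σˣ_i` (Pfeuty 1970, with `J = 1`, field `Γ = h`, and the roles of
`σˣ, σᶻ` exchanged so that the Ising coupling is diagonal in the spin basis `Row N`). [cite: PfeutyAnnPhys1970, §1 (the Hamiltonian)] -/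
def tfiHam (h : ℝ) : Matrix (Row N) (Row N) ℝ := -Matrix.diagonal ringEnergy - h • flipSum N

omit [NeZero N] in
/-- Right multiplication by the transverse field: `(M ∑_i σˣ_i)(r, r') = ∑_i M(r, flip_i r')`. [folklore] -/
theorem mul_flipSum_apply (M : Matrix (Row N) (Row N) ℝ) (r r' : Row N) :
    (M * flipSum N) r r' = ∑ i, M r (Row.flipAt i r') := by
  rw [flipSum, Finset.mul_sum, Matrix.sum_apply]
  exact Finset.sum_congr rfl fun i _ => mul_sigmaX_apply i M r r'

omit [NeZero N] in
/-- Left multiplication by the transverse field: `(∑_i σˣ_i M)(r, r') = ∑_i M(flip_i r, r')`. [folklore] -/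
theorem flipSum_mul_apply (M : Matrix (Row N) (Row N) ℝ) (r r' : Row N) :
    (flipSum N * M) r r' = ∑ i, M (Row.flipAt i r) r' := by
  rw [flipSum, Finset.sum_mul, Matrix.sum_apply]
  exact Finset.sum_congr rfl fun i _ => sigmaX_mul_apply i M r r'

/-- `M H` entrywise: `(M H)(r, r') = -M(r, r') E(r') - h ∑_i M(r, flip_i r')`. [folklore] -/
theorem mul_tfiHam_apply (h : ℝ) (M : Matrix (Row N) (Row N) ℝ) (r r' : Row N) :
    (M * tfiHam N h) r r' = -(M r r' * ringEnergy r') - h * ∑ i, M r (Row.flipAt i r') := by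
  rw [tfiHam, Matrix.mul_sub, Matrix.mul_neg, Matrix.mul_smul, Matrix.sub_apply, Matrix.neg_apply,
    Matrix.smul_apply, mul_diagonal, mul_flipSum_apply, smul_eq_mul]

/-- `H M` entrywise: `(H M)(r, r') = -E(r) M(r, r') - h ∑_i M(flip_i r, r')`. [folklore] -/
theorem tfiHam_mul_apply (h : ℝ) (M : Matrix (Row N) (Row N) ℝ) (r r' : Row N) :
    (tfiHam N h * M) r r' = -(ringEnergy r * M r r') - h * ∑ i, M (Row.flipAt i r) r' := by
  rw [tfiHam, Matrix.sub_mul, Matrix.neg_mul, Matrix.smul_mul, Matrix.sub_apply, Matrix.neg_apply,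
    Matrix.smul_apply, diagonal_mul, flipSum_mul_apply, smul_eq_mul]

/-- Entries of `H`. [folklore] -/
theorem tfiHam_apply (h : ℝ) (r r' : Row N) :
    tfiHam N h r r' = -(Matrix.diagonal ringEnergy r r') - h * ∑ i, sigmaX i r r' := by
  simp only [tfiHam, flipSum, Matrix.sub_apply, Matrix.neg_apply, Matrix.smul_apply, Matrix.sum_apply, smul_eq_mul]

/-- `H` is symmetric. [folklore] -/
theorem tfiHam_isHermitian (h : ℝ) : (tfiHam N h).IsHermitian := by
  rw [Matrix.IsHermitian, conjTranspose_eq_transpose_of_trivial]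
  ext r r'
  rw [transpose_apply, tfiHam_apply, tfiHam_apply, diagonal_apply, diagonal_apply]
  congr 1
  · by_cases hrr : r' = r
    · subst hrr; rfl
    · rw [if_neg hrr, if_neg (Ne.symm hrr)]
  · congr 1
    exact Finset.sum_congr rfl fun i _ => sigmaX_apply_comm i r' r

/-! ### The local identity and the telescoping -/

omit [NeZero N] in
/-- **The local identity**: for spins `s, a, b = ±1`,
`e^{-2β s (a + b)} = 1 + (cosh 4β - 1)(1 + ab)/2 - (sinh 4β / 2) s (a + b)` (both sides are `e^{∓4β}`
when `a = b = ±s·1` and `1` when `a = -b`). [folklore] -/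
theorem exp_neg_two_mul_spin_sum (β : ℝ) {s a b : ℝ} (hs : s = 1 ∨ s = -1) (ha : a = 1 ∨ a = -1)
    (hb : b = 1 ∨ b = -1) :
    Real.exp (-(2 * β) * (s * (a + b))) =
      1 + (Real.cosh (4 * β) - 1) * ((1 + a * b) / 2) - Real.sinh (4 * β) / 2 * (s * (a + b)) := by
  -- `t = s (a + b) ∈ {-2, 0, 2}` and `a b = 1` exactly when `t ≠ 0`
  have key : ∀ t u : ℝ, ((t = 2 ∧ u = 1) ∨ (t = -2 ∧ u = 1) ∨ (t = 0 ∧ u = -1)) →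
      Real.exp (-(2 * β) * t) = 1 + (Real.cosh (4 * β) - 1) * ((1 + u) / 2) - Real.sinh (4 * β) / 2 * t := by
    rintro t u (⟨rfl, rfl⟩ | ⟨rfl, rfl⟩ | ⟨rfl, rfl⟩)
    · rw [show -(2 * β) * 2 = -(4 * β) by ring, ← Real.cosh_sub_sinh]; ring
    · rw [show -(2 * β) * -2 = 4 * β by ring, ← Real.cosh_add_sinh]; ring
    · rw [mul_zero, Real.exp_zero]; ring
  refine key (s * (a + b)) (a * b) ?_
  rcases hs with rfl | rfl <;> rcases ha with rfl | rfl <;> rcases hb with rfl | rfl <;> norm_num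

/-- **Telescoping around the ring**: `∑_i r_i r'_{i-1} = ∑_i r_{i+1} r'_i`. [folklore] -/
theorem sum_spin_mul_spin_pred (r r' : Row N) :
    ∑ i, spinAt i r * spinAt (i - 1) r' = ∑ i, spinAt (i + 1) r * spinAt i r' := by
  rw [← Equiv.sum_comp (Equiv.addRight (1 : Fin N))]
  refine Finset.sum_congr rfl fun i _ => ?_
  simp only [Equiv.coe_addRight, add_sub_cancel_right]

/-- The ring energy read backwards: `∑_i r_i r_{i-1} = E(r)`. [folklore] -/
theorem sum_spin_mul_spin_pred_self (r : Row N) : ∑ i, spinAt i r * spinAt (i - 1) r = ringEnergy r := by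
  rw [sum_spin_mul_spin_pred, ringEnergy]
  exact Finset.sum_congr rfl fun i _ => mul_comm _ _

omit [NeZero N] in
/-- **The field at which the chain commutes with the diagonal transfer matrix**:
`h(β) = (sinh 2β)⁻²` (`= 1` at `β = β_c(2)`, where `sinh 2β_c = 1`; Suzuki 1971, "appropriate
relations among coupling parameters"). [cite: SuzukiPTP1971, abstract and main theorem (2D Ising transfer matrix vs. quantum chain in a field)] -/
def diagField (β : ℝ) : ℝ := ((Real.sinh (2 * β))⁻¹) ^ 2

omit [NeZero N] in
/-- `cosh 4β - 1 = 2 sinh² 2β`. [folklore] -/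
theorem cosh_four_mul_sub_one (β : ℝ) : Real.cosh (4 * β) - 1 = 2 * Real.sinh (2 * β) ^ 2 := by
  rw [show (4 : ℝ) * β = 2 * (2 * β) by ring, Real.cosh_two_mul, Real.cosh_sq]
  ring

omit [NeZero N] in
/-- The defining relation of the field: `h(β) · (cosh 4β - 1)/2 = 1` for `β ≠ 0`. [folklore] -/
theorem diagField_mul_cosh_sub_one {β : ℝ} (hβ : β ≠ 0) :
    diagField β * ((Real.cosh (4 * β) - 1) / 2) = 1 := by
  have hs : Real.sinh (2 * β) ≠ 0 := by
    rw [Ne, Real.sinh_eq_zero]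
    exact mul_ne_zero two_ne_zero hβ
  rw [diagField, cosh_four_mul_sub_one]
  field_simp

/-! ### The commutation theorem -/

/-- **Suzuki's commutation** (M. Suzuki, Prog. Theor. Phys. 46 (1971) 1337: "relating a transfer
matrix associated with a classical system to the Hamiltonian of its corresponding quantum mechanical
system"; here in the sharp form of an exact commutation at finite `N`): the one-layer diagonal transfer kernel of the square-lattice Ising model at inverse
temperature `β ≠ 0` COMMUTES with the transverse-field Ising chain at the field `h = (sinh 2β)⁻²`:
`K H = H K`. Proof: entrywise, after division by `K(r, r'') > 0`, the identity to prove is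
`E(r'') - E(r) = h ∑_i [e^{-2β r_i (r''_i + r''_{i-1})} - e^{-2β r''_i (r_i + r_{i+1})}]`; expand
both exponentials by `exp_neg_two_mul_spin_sum`: the `sinh 4β` terms cancel after the telescoping
`∑_i r_i r''_{i-1} = ∑_i r_{i+1} r''_i`, the `cosh 4β - 1` terms give `(cosh 4β - 1)/2 · (E(r'') - E(r))`,
and `h (cosh 4β - 1)/2 = 1`. [cite: SuzukiPTP1971, abstract and main theorem (2D Ising transfer matrix vs. quantum chain in a field)] -/
theorem diagKernel_mul_tfiHam {β : ℝ} (hβ : β ≠ 0) :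
    diagKernel N β * tfiHam N (diagField β) = tfiHam N (diagField β) * diagKernel N β := by
  ext r r''
  rw [mul_tfiHam_apply, tfiHam_mul_apply]
  simp only [diagKernel_flipAt_right, diagKernel_flipAt_left, ← Finset.mul_sum]
  -- reduce to the scalar identity `E(r'') - E(r) = h (∑ left ratios - ∑ right ratios)`
  set h := diagField β with hh
  set K := diagKernel N β r r'' with hK
  suffices key : ringEnergy r'' - ringEnergy r =
      h * (∑ i, Real.exp (-(2 * β) * (spinAt i r * (spinAt i r'' + spinAt (i - 1) r''))) -
        ∑ i, Real.exp (-(2 * β) * (spinAt i r'' * (spinAt i r + spinAt (i + 1) r)))) by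
    have : K * (ringEnergy r'' - ringEnergy r) = K * (h * ((∑ i, Real.exp (-(2 * β) *
        (spinAt i r * (spinAt i r'' + spinAt (i - 1) r'')))) -
        ∑ i, Real.exp (-(2 * β) * (spinAt i r'' * (spinAt i r + spinAt (i + 1) r))))) := by rw [key]
    linear_combination -this
  -- expand the exponentials
  have hL : ∀ i : Fin N, Real.exp (-(2 * β) * (spinAt i r * (spinAt i r'' + spinAt (i - 1) r''))) =
      1 + (Real.cosh (4 * β) - 1) * ((1 + spinAt i r'' * spinAt (i - 1) r'') / 2) -
        Real.sinh (4 * β) / 2 * (spinAt i r * (spinAt i r'' + spinAt (i - 1) r'')) :=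
    fun i => exp_neg_two_mul_spin_sum β (spinAt_eq_one_or_eq_neg_one i r) (spinAt_eq_one_or_eq_neg_one i r'')
      (spinAt_eq_one_or_eq_neg_one (i - 1) r'')
  have hR : ∀ i : Fin N, Real.exp (-(2 * β) * (spinAt i r'' * (spinAt i r + spinAt (i + 1) r))) =
      1 + (Real.cosh (4 * β) - 1) * ((1 + spinAt i r * spinAt (i + 1) r) / 2) -
        Real.sinh (4 * β) / 2 * (spinAt i r'' * (spinAt i r + spinAt (i + 1) r)) :=
    fun i => exp_neg_two_mul_spin_sum β (spinAt_eq_one_or_eq_neg_one i r'') (spinAt_eq_one_or_eq_neg_one i r)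
      (spinAt_eq_one_or_eq_neg_one (i + 1) r)
  simp only [hL, hR]
  -- the sums, term by term
  have hsumL : ∑ i, (1 + (Real.cosh (4 * β) - 1) * ((1 + spinAt i r'' * spinAt (i - 1) r'') / 2) -
      Real.sinh (4 * β) / 2 * (spinAt i r * (spinAt i r'' + spinAt (i - 1) r''))) =
      (N : ℝ) + (Real.cosh (4 * β) - 1) * (((N : ℝ) + ringEnergy r'') / 2) -
        Real.sinh (4 * β) / 2 * (∑ i, spinAt i r * spinAt i r'' + ∑ i, spinAt (i + 1) r * spinAt i r'') := by
    rw [← sum_spin_mul_spin_pred r r'', ← sum_spin_mul_spin_pred_self r'']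
    simp only [Finset.sum_sub_distrib, Finset.sum_add_distrib, Finset.sum_const, Finset.card_univ,
      Fintype.card_fin, nsmul_eq_mul, mul_one, ← Finset.mul_sum, ← Finset.sum_div, mul_add]
  have hsumR : ∑ i, (1 + (Real.cosh (4 * β) - 1) * ((1 + spinAt i r * spinAt (i + 1) r) / 2) -
      Real.sinh (4 * β) / 2 * (spinAt i r'' * (spinAt i r + spinAt (i + 1) r))) =
      (N : ℝ) + (Real.cosh (4 * β) - 1) * (((N : ℝ) + ringEnergy r) / 2) -
        Real.sinh (4 * β) / 2 * (∑ i, spinAt i r * spinAt i r'' + ∑ i, spinAt (i + 1) r * spinAt i r'') := by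
    have e1 : ∑ i, spinAt i r'' * spinAt i r = ∑ i, spinAt i r * spinAt i r'' :=
      Finset.sum_congr rfl fun i _ => mul_comm _ _
    have e2 : ∑ i, spinAt i r'' * spinAt (i + 1) r = ∑ i, spinAt (i + 1) r * spinAt i r'' :=
      Finset.sum_congr rfl fun i _ => mul_comm _ _
    rw [← e1, ← e2, ringEnergy]
    simp only [Finset.sum_sub_distrib, Finset.sum_add_distrib, Finset.sum_const, Finset.card_univ,
      Fintype.card_fin, nsmul_eq_mul, mul_one, ← Finset.mul_sum, ← Finset.sum_div, mul_add]
  rw [hsumL, hsumR]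
  have hfield := diagField_mul_cosh_sub_one hβ
  rw [← hh] at hfield
  linear_combination -(ringEnergy r'' - ringEnergy r) * hfield

/-- Transposed form: `Kᵀ H = H Kᵀ` (`H` is symmetric). [folklore] -/
theorem diagKernel_transpose_mul_tfiHam {β : ℝ} (hβ : β ≠ 0) :
    (diagKernel N β)ᵀ * tfiHam N (diagField β) = tfiHam N (diagField β) * (diagKernel N β)ᵀ := by
  have hH : (tfiHam N (diagField β))ᵀ = tfiHam N (diagField β) := by
    have := tfiHam_isHermitian (N := N) (diagField β)
    rwa [Matrix.IsHermitian, conjTranspose_eq_transpose_of_trivial] at this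
  have := congrArg Matrix.transpose (diagKernel_mul_tfiHam (N := N) hβ)
  rw [transpose_mul, transpose_mul, hH] at this
  exact this.symm

/-- **The two-layer diagonal transfer matrix commutes with the transverse-field Ising chain**:
`T₂ H = H T₂` at `h = (sinh 2β)⁻²` (Suzuki 1971). [cite: SuzukiPTP1971, abstract and main theorem (2D Ising transfer matrix vs. quantum chain in a field)] -/
theorem diagTwoLayer_mul_tfiHam {β : ℝ} (hβ : β ≠ 0) :
    diagTwoLayer N β * tfiHam N (diagField β) = tfiHam N (diagField β) * diagTwoLayer N β := by
  rw [diagTwoLayer, Matrix.mul_assoc, diagKernel_mul_tfiHam hβ, ← Matrix.mul_assoc,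
    diagKernel_transpose_mul_tfiHam hβ, Matrix.mul_assoc]

/-- At the critical point the commuting chain is the CRITICAL transverse-field Ising chain:
`h(β_c(2)) = 1` (`sinh 2β_c(2) = 1`). [folklore] -/
theorem diagField_criticalBetaTwo : diagField criticalBetaTwo = 1 := by
  rw [diagField, sinh_two_mul_criticalBetaTwo, inv_one, one_pow]

end Literature.Probability.LatticeModels
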